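import Summits.ResolutionOfSingularities.ResolutionOfSingularities.Theorems.PurelyInseparableDim4ChartClosureIdeal
import Summits.ResolutionOfSingularities.ResolutionOfSingularities.Theorems.PurelyInseparableDim4ChartCentreClosed
import Summits.ResolutionOfSingularities.ResolutionOfSingularities.Theorems.PurelyInseparableDim4ChartStep
import Literature.AlgebraicGeometry.Resolution.DerivativeIdealsSupport
import HarnessLib

/-!
# Purely inseparable four-folds `z^p + F(x₁, …, x₄)`: the closure of an (escaping) chart centre lies in the
# SUPPORT of the transformed marked ideal — Q2 of the S3-glob question at depth 2, every `S'`
# (brick S3-glob, part D1; cell `res-dim4-pi`, typ-2 g4)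

[OURS · counted 0] (D-0157 DOOR 2; DR-157-C; desk WORD #97 (c); frame `PIDim4.TerminationImpliesOrderReduction`,
S3 (c)). Setting of `…ChartCentreClosed` §4: `π : W → 𝔸⁵_K` ANY blowing up along `V(z, x_S)`, `j ∈ S`, `Θ` a
re-centring automorphism, `φ = Spec Θ ≫ chartImm_j`, `S'` the next centre, `Zc = 𝓘(closure φ(V(z, x_{S'})))` its
global centre. With the RING READING `Θ(ψ(z^p + F)) = x_j^p (z^p + F₁)` (A2) and `p ≤ ord_{(x_{S'})} F₁`, for
EVERY `S'` (escaping or not, inside the exceptional divisor or not), over a PERFECT field `K` of characteristic `p`: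

* `isClosed_support_of_isBlowup_𝓘Λ` — on a blow-up `W` of `𝔸⁵_K` along a coordinate subspace, the support of
  every marked ideal of multiplicity `≤ p` is CLOSED (`W → Spec K` is smooth, tree `AffineCoordBlowup.smooth_comp`;
  BGMW §3.1 Rem. (3) / Lemma 3.5.2 with Thm. 8.0.4, tree `MarkedIdeal.isClosed_support_of_smooth`);
* `comap_chart_transform_ideal_of_reading` — the transform of `M = ((z^p+F)·𝒪, E, p)` reads `(z^p + F₁)·𝒪` on the
  re-centred chart; `image_chart_subset_support_transform` — `φ(V(z, x_{S'})) ⊆ supp(M.transform π 𝓘Λ_S)`;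
* **`support_globalCentre_subset_support_transform_of_reading`** — `V(Zc) = closure φ(V(z, x_{S'})) ⊆ supp` —
  Q2 of the signature of record (for the root marked ideal `E = []` this is literally
  `support_globalCentre_subset_support_transform`).

Nothing here is a statement about resolution of singularities in dimension ≥ 4 / characteristic `p` (NOT proved
anywhere in this programme). bears_on: LADDER-RESOLUTION:D157-DOOR2 (res-dim4-pi). Supports
stmt-ResolutionOfSingularities-16155 (helper, S3-glob D1).
-/

-- every declaration of this summit lives under `Summit.ResolutionOfSingularities.ResolutionOfSingularities`
-- (summit = problem), which the duplicate-namespace linter flags; house convention (cf. the Target file).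
set_option linter.dupNamespace false

noncomputable section

open MvPolynomial Finset CategoryTheory AlgebraicGeometry Opposite TopologicalSpace
open AlgebraicGeometry.Scheme.IdealSheafData (ofIdealTop vanishingIdeal)

namespace Summit.ResolutionOfSingularities.ResolutionOfSingularities.Theorems.PIDim4

open Literature.AlgebraicGeometry.Resolution
open Literature.AlgebraicGeometry.Resolution.AffinePointBlowup (P A γ coord Wtop ξ)

namespace ChartDictionary

variable {K : Type} [Field K] {p : ℕ} {S S' : Finset (Fin 4)} {j : Fin 4} {b : Fin 4 → K}
  {Θ : A 4 K ≃ₐ[K] A 4 K} {h : MvPolynomial (Fin 4) K} {F F₁ : MvPolynomial (Fin 4) K}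
  {W : Scheme.{0}} {π : W ⟶ P 4 K}

/-! ## §1 Supports are closed on a blow-up of `𝔸⁵` along a coordinate subspace -/

/-- **Closedness of the support** of a marked ideal of multiplicity `≤ p` on any blowing up `W` of `𝔸⁵_K` along a
coordinate subspace, `K` a perfect field of characteristic `p` (`W` is smooth over `K`). -/
theorem isClosed_support_of_isBlowup_𝓘Λ [CharP K p] [PerfectField K]
    {Λ : Set (Fin (4 + 1))} (hπ : IsBlowup π (AffineCoordBlowup.𝓘Λ 4 K Λ)) (M' : MarkedIdeal W)
    (hμ : M'.mult ≤ p) : IsClosed M'.support := by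
  letI : W.Over (Spec (.of K)) := ⟨π ≫ AffinePointBlowup.f 4 K⟩
  haveI : Smooth (W ↘ Spec (.of K)) := AffineCoordBlowup.smooth_comp hπ
  exact MarkedIdeal.isClosed_support_of_smooth K W p M' (Or.inr hμ)

/-! ## §2 The chart image lies in the support -/

/-- **The transform reads `(z^p + F₁)·𝒪` on the re-centred chart**: for a marked ideal `M` on `𝔸⁵` with
`M.ideal = (z^p + F)·𝒪` and `M.mult = p` (any boundary), `φ^* (M.transform π 𝓘Λ_S).ideal = (z^p + F₁)·𝒪`. -/
theorem comap_chart_transform_ideal_of_reading [Fact p.Prime] [CharP K p] (hj : j ∈ S) (hbj : b j = 0)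
    (h0 : Θ (X 0) = X 0 + rename Fin.succ h) (hs : ∀ i : Fin 4, Θ (X i.succ) = X i.succ + C (b i))
    (hπ : IsBlowup π (AffineCoordBlowup.𝓘Λ 4 K (insert 0 (Fin.succ '' (S : Set (Fin 4))))))
    (hperm : (p : ℕ∞) ≤ CentreBlowup.ordAlong S F)
    (hread : Θ (coordBlowupSubst K (insert 0 (Fin.succ '' (S : Set (Fin 4)))) j.succ (hyp p F)) =
      X j.succ ^ p * hyp p F₁)
    (M : MarkedIdeal (P 4 K)) (hMI : M.ideal = hypSheaf p F) (hMm : M.mult = p) :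
    (M.transform π (AffineCoordBlowup.𝓘Λ 4 K (insert 0 (Fin.succ '' (S : Set (Fin 4)))))).ideal.comap
        (Spec.map (CommRingCat.ofHom (Θ : A 4 K →+* A 4 K)) ≫ AffineCoordBlowup.chartImm hπ (succ_mem_centreVars hj)) =
      hypSheaf p F₁ := by
  have hΘ : Θ (hyp p (CentreBlowup.chartTransform p S j F)) = hyp p F₁ := by
    rw [clean_hyp_translate h0 hs, ← eq_pow_add_translate_of_reading hj hbj h0 hs hperm hread]
  rw [MarkedIdeal.transform_ideal, hMI, hMm, Scheme.IdealSheafData.comap_comp,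
    controlledTransform_comap_chartImm p hj F hperm hπ, comap_hypSheaf_specMap]
  change ofIdealTop (Ideal.span {(γ 4 K).symm (Θ (hyp p (CentreBlowup.chartTransform p S j F)))}) = _
  rw [hΘ]
  rfl

/-- **`φ(V(z, x_{S'})) ⊆ supp(M.transform π 𝓘Λ_S)`** for `S'` permissible for `F₁` (orders are read on the chart). -/
theorem image_chart_subset_support_transform [Fact p.Prime] [CharP K p] (hj : j ∈ S) (hbj : b j = 0)
    (h0 : Θ (X 0) = X 0 + rename Fin.succ h) (hs : ∀ i : Fin 4, Θ (X i.succ) = X i.succ + C (b i))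
    (hπ : IsBlowup π (AffineCoordBlowup.𝓘Λ 4 K (insert 0 (Fin.succ '' (S : Set (Fin 4))))))
    (hperm : (p : ℕ∞) ≤ CentreBlowup.ordAlong S F)
    (hread : Θ (coordBlowupSubst K (insert 0 (Fin.succ '' (S : Set (Fin 4)))) j.succ (hyp p F)) =
      X j.succ ^ p * hyp p F₁)
    (hperm' : (p : ℕ∞) ≤ CentreBlowup.ordAlong S' F₁)
    (M : MarkedIdeal (P 4 K)) (hMI : M.ideal = hypSheaf p F) (hMm : M.mult = p) :
    haveI : IsIso (CommRingCat.ofHom (Θ : A 4 K →+* A 4 K)) :=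
      (inferInstance : IsIso Θ.toRingEquiv.toCommRingCatIso.hom)
    (Spec.map (CommRingCat.ofHom (Θ : A 4 K →+* A 4 K)) ≫ AffineCoordBlowup.chartImm hπ (succ_mem_centreVars hj)) ''
        (AffineCoordBlowup.CΛ 4 K (insert 0 (Fin.succ '' (S' : Set (Fin 4)))) : Set (P 4 K)) ⊆
      (M.transform π (AffineCoordBlowup.𝓘Λ 4 K (insert 0 (Fin.succ '' (S : Set (Fin 4)))))).support := by
  haveI : IsIso (CommRingCat.ofHom (Θ : A 4 K →+* A 4 K)) :=
    (inferInstance : IsIso Θ.toRingEquiv.toCommRingCatIso.hom)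
  rintro _ ⟨y, hy, rfl⟩
  change ((M.transform π _).mult : ℕ∞) ≤ idealOrder (M.transform π _).ideal _
  rw [MarkedIdeal.transform_mult, hMm, ← idealOrder_comap_of_isOpenImmersion _ _ y,
    comap_chart_transform_ideal_of_reading hj hbj h0 hs hπ hperm hread M hMI hMm]
  exact le_idealOrder_hypSheaf_of_mem_CΛ p S' F₁ hperm' hy

/-! ## §3 Q2: the global centre lies in the support -/

/-- **Q2 OF THE S3-GLOB QUESTION (every `S'`).** Over a perfect field of characteristic `p`: the global centre
`Zc = 𝓘(closure φ(V(z, x_{S'})))` of an arbitrary next coordinate centre lies in the support of the transform of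
any marked ideal `M = ((z^p + F)·𝒪, E, p)`: `V(Zc) ⊆ supp(M.transform π 𝓘Λ_S)` (the chart image does, and the
support is closed). -/
theorem support_globalCentre_subset_support_transform_of_reading [Fact p.Prime] [CharP K p] [PerfectField K]
    (hj : j ∈ S) (hbj : b j = 0) (h0 : Θ (X 0) = X 0 + rename Fin.succ h)
    (hs : ∀ i : Fin 4, Θ (X i.succ) = X i.succ + C (b i))
    (hπ : IsBlowup π (AffineCoordBlowup.𝓘Λ 4 K (insert 0 (Fin.succ '' (S : Set (Fin 4))))))
    (hperm : (p : ℕ∞) ≤ CentreBlowup.ordAlong S F)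
    (hread : Θ (coordBlowupSubst K (insert 0 (Fin.succ '' (S : Set (Fin 4)))) j.succ (hyp p F)) =
      X j.succ ^ p * hyp p F₁)
    (hperm' : (p : ℕ∞) ≤ CentreBlowup.ordAlong S' F₁)
    (M : MarkedIdeal (P 4 K)) (hMI : M.ideal = hypSheaf p F) (hMm : M.mult = p) :
    haveI : IsIso (CommRingCat.ofHom (Θ : A 4 K →+* A 4 K)) :=
      (inferInstance : IsIso Θ.toRingEquiv.toCommRingCatIso.hom)
    ((vanishingIdeal (closureImage
      (Spec.map (CommRingCat.ofHom (Θ : A 4 K →+* A 4 K)) ≫ AffineCoordBlowup.chartImm hπ (succ_mem_centreVars hj))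
      ((AffineCoordBlowup.𝓘Λ 4 K (insert 0 (Fin.succ '' (S' : Set (Fin 4))))).support : Set (P 4 K)))).support :
        Set W) ⊆
      (M.transform π (AffineCoordBlowup.𝓘Λ 4 K (insert 0 (Fin.succ '' (S : Set (Fin 4)))))).support := by
  rw [Scheme.IdealSheafData.coe_support_vanishingIdeal, coe_closureImage, AffineCoordBlowup.support_𝓘Λ]
  refine (isClosed_support_of_isBlowup_𝓘Λ hπ _ (by rw [MarkedIdeal.transform_mult, hMm])).closure_subset_iff.mpr ?_
  exact image_chart_subset_support_transform hj hbj h0 hs hπ hperm hread hperm' M hMI hMm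

/-- **Q2, signature of record** (root marked ideal `((z^p + F)·𝒪, [], p)`). -/
theorem support_globalCentre_subset_support_transform [Fact p.Prime] [CharP K p] [PerfectField K]
    (hj : j ∈ S) (hbj : b j = 0) (h0 : Θ (X 0) = X 0 + rename Fin.succ h)
    (hs : ∀ i : Fin 4, Θ (X i.succ) = X i.succ + C (b i))
    (hπ : IsBlowup π (AffineCoordBlowup.𝓘Λ 4 K (insert 0 (Fin.succ '' (S : Set (Fin 4))))))
    (hperm : (p : ℕ∞) ≤ CentreBlowup.ordAlong S F)
    (hread : Θ (coordBlowupSubst K (insert 0 (Fin.succ '' (S : Set (Fin 4)))) j.succ (hyp p F)) =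
      X j.succ ^ p * hyp p F₁)
    (hperm' : (p : ℕ∞) ≤ CentreBlowup.ordAlong S' F₁) :
    haveI : IsIso (CommRingCat.ofHom (Θ : A 4 K →+* A 4 K)) :=
      (inferInstance : IsIso Θ.toRingEquiv.toCommRingCatIso.hom)
    ((vanishingIdeal (closureImage
      (Spec.map (CommRingCat.ofHom (Θ : A 4 K →+* A 4 K)) ≫ AffineCoordBlowup.chartImm hπ (succ_mem_centreVars hj))
      ((AffineCoordBlowup.𝓘Λ 4 K (insert 0 (Fin.succ '' (S' : Set (Fin 4))))).support : Set (P 4 K)))).support :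
        Set W) ⊆
      ((⟨hypSheaf p F, [], p⟩ : MarkedIdeal (P 4 K)).transform π
        (AffineCoordBlowup.𝓘Λ 4 K (insert 0 (Fin.succ '' (S : Set (Fin 4)))))).support :=
  support_globalCentre_subset_support_transform_of_reading hj hbj h0 hs hπ hperm hread hperm' _ rfl rfl

end ChartDictionary

end Summit.ResolutionOfSingularities.ResolutionOfSingularities.Theorems.PIDim4

end
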